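import Mathlib.Data.Nat.Bitwise
import Literature.Computability.AlgebraicComplexity.FSV18SuccinctGenerators
import Literature.Computability.AlgebraicComplexity.FSV2018ROABP

/-!
# FSV Thm. 10 (ToC Thm. 1.11) from Lemma 55: the BRIDGE between the two renderings of
# "monomial-compatible ordering" (§7.1)

Forbes–Shpilka–Volk 2018, §7.1: an ordering of the `N = 2ⁿ` coefficient coordinates `c_b`
(`b ∈ {0,1}ⁿ`) is *monomial compatible* if it is the lexicographic order of the multilinear
monomials induced by some order of the small variables `x_1, …, x_n`. The tree carries TWO
renderings: t18's predicate `IsMonomialCompatible π` (`FSV18SuccinctGenerators.lean`: `π` is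
order-isomorphic to the lex order read along a priority permutation) and t21's explicit orders
`monomialCompatibleOrder σ` (`FSV2018ROABP.lean`: the binary order after permuting the small
variables by `σ`), over which Cor. 60 (`ForbesShpilkaVolk2018_cor60`, from the named fact Lemma 55)
is proved. This file proves they MATCH,

* `isMonomialCompatible_iff : IsMonomialCompatible π ↔ ∃ σ, π = monomialCompatibleOrder σ`
  (the binary order of `Fin (2ⁿ)` is the lexicographic order of the bit vectors read from the most
  significant bit; a strictly monotone bijection between finite linear orders is unique),

and derives the named fact **Thm. 10** (`FSV2018_thm10`, as re-typed with the guard `0 < n` in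
p421345 after the `n = 0` refutation) from Lemma 55:

* `FSV2018_thm10_of_lemma55 : (∀ F, ForbesShpilkaVolk2018_lemma55 F) → FSV2018_thm10` (Cor. 60's
  argument with the explicit multilinear witness `rename σ (fsPoly …)`, admissible parameters from
  `exists_fsParams`; width `w = 0` is vacuous since `IsROABP` carries `0 < w`).

References: [ForbesShpilkaVolk2018] §7.1 (monomial-compatible orderings), Thm. 10 (seq.) = ToC
Thm. 1.11, Lemma 55, Cor. 60 (seq.) = ToC Cor. 7.6.
-/

noncomputable section

namespace Literature.Computability.AlgebraicComplexity

open MvPolynomial Literature.Barriers.ValiantsHypothesis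

namespace FSV2018Thm10Bridge

variable {n : ℕ}

/-! ### Bits of `j < 2ⁿ` and the lexicographic order from the most significant bit -/

/-- The lex order on `Fin n → ℕ` unfolded. [folklore] -/
private theorem toLex_lt_iff {x y : Fin n → ℕ} :
    toLex x < toLex y ↔ ∃ i, (∀ j, j < i → x j = y j) ∧ x i < y i := Iff.rfl

/-- The `k`-th binary digit of `j` as read by `finFunctionFinEquiv.symm`. [folklore] -/
private theorem finFunctionFinEquiv_symm_val (j : Fin (2 ^ n)) (k : Fin n) :
    ((finFunctionFinEquiv.symm j) k : ℕ) = (j : ℕ) / 2 ^ (k : ℕ) % 2 := rfl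

/-- `testBit` versus the digit `j / 2^k % 2`. [folklore] -/
private theorem testBit_eq_true_iff (x k : ℕ) : x.testBit k = true ↔ x / 2 ^ k % 2 = 1 := by
  rw [Nat.testBit_eq_decide_div_mod_eq, decide_eq_true_iff]

/-- `testBit = false` versus the digit `j / 2^k % 2 = 0`. [folklore] -/
private theorem testBit_eq_false_iff (x k : ℕ) : x.testBit k = false ↔ x / 2 ^ k % 2 = 0 := by
  rw [Nat.testBit_eq_decide_div_mod_eq, decide_eq_false_iff_not]
  have := Nat.mod_two_eq_zero_or_one (x / 2 ^ k)
  omega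

/-- Two numbers have the same `k`-th bit iff the same `k`-th digit. [folklore] -/
private theorem testBit_eq_testBit_iff (x y k : ℕ) :
    x.testBit k = y.testBit k ↔ x / 2 ^ k % 2 = y / 2 ^ k % 2 := by
  have hx := Nat.mod_two_eq_zero_or_one (x / 2 ^ k)
  have hy := Nat.mod_two_eq_zero_or_one (y / 2 ^ k)
  constructor
  · intro h
    rcases hx with hx | hx <;> rcases hy with hy | hy
    · rw [hx, hy]
    · rw [← testBit_eq_false_iff] at hx; rw [← testBit_eq_true_iff] at hy
      rw [hx, hy] at h; exact absurd h (by decide)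
    · rw [← testBit_eq_true_iff] at hx; rw [← testBit_eq_false_iff] at hy
      rw [hx, hy] at h; exact absurd h (by decide)
    · rw [hx, hy]
  · intro h
    rcases hy with hy | hy
    · rw [(testBit_eq_false_iff y k).mpr hy, (testBit_eq_false_iff x k).mpr (h.trans hy)]
    · rw [(testBit_eq_true_iff y k).mpr hy, (testBit_eq_true_iff x k).mpr (h.trans hy)]

/-- If `a ≠ b` (both `< 2ⁿ`) there is a most significant differing bit, and it is `< n`. [folklore] -/
private theorem exists_msb_ne {a b : ℕ} (ha : a < 2 ^ n) (hb : b < 2 ^ n) (hab : a ≠ b) :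
    ∃ k, k < n ∧ a.testBit k ≠ b.testBit k ∧ ∀ j, k < j → a.testBit j = b.testBit j := by
  have hx : a ^^^ b ≠ 0 := by
    intro h0
    apply hab
    refine Nat.eq_of_testBit_eq fun i => ?_
    have := Nat.testBit_xor a b i
    rw [h0, Nat.zero_testBit] at this
    revert this
    cases a.testBit i <;> cases b.testBit i <;> simp
  obtain ⟨k, hk, hk'⟩ := Nat.exists_most_significant_bit hx
  refine ⟨k, ?_, ?_, fun j hj => ?_⟩
  · by_contra hkn
    push Not at hkn
    have hlt : a ^^^ b < 2 ^ k :=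
      (Nat.xor_lt_two_pow ha hb).trans_le (Nat.pow_le_pow_right (by norm_num) hkn)
    rw [Nat.testBit_lt_two_pow hlt] at hk
    exact absurd hk (by decide)
  · rw [Nat.testBit_xor] at hk
    revert hk
    cases a.testBit k <;> cases b.testBit k <;> simp
  · have := hk' j hj
    rw [Nat.testBit_xor] at this
    revert this
    cases a.testBit j <;> cases b.testBit j <;> simp

/-- **The binary order is the lexicographic order of the bit vectors read from the most
significant bit** ("the canonical identification of a multilinear monomial with an index in `[N]`,
say, using the binary representation", §7.1). [cite: ForbesShpilkaVolk2018, §7.1] -/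
theorem lt_iff_toLex_bits_lt (a b : Fin (2 ^ n)) :
    a < b ↔ toLex (fun i : Fin n => (a : ℕ) / 2 ^ ((Fin.rev i : Fin n) : ℕ) % 2) <
      toLex (fun i : Fin n => (b : ℕ) / 2 ^ ((Fin.rev i : Fin n) : ℕ) % 2) := by
  rw [toLex_lt_iff]
  constructor
  · intro hab
    have hab' : (a : ℕ) ≠ b := fun h => (Fin.ext h ▸ hab).false.elim
    obtain ⟨k, hkn, hne, habove⟩ := exists_msb_ne a.isLt b.isLt hab'
    -- at the most significant differing bit, `a` has `0` and `b` has `1`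
    have hbits : (a : ℕ).testBit k = false ∧ (b : ℕ).testBit k = true := by
      cases ha : (a : ℕ).testBit k <;> cases hb : (b : ℕ).testBit k
      · rw [ha, hb] at hne; exact absurd rfl hne
      · exact ⟨rfl, rfl⟩
      · exact absurd (Nat.lt_of_testBit k hb ha fun j hj => (habove j hj).symm)
          (lt_asymm (Fin.lt_def.mp hab))
      · rw [ha, hb] at hne; exact absurd rfl hne
    refine ⟨Fin.rev ⟨k, hkn⟩, fun j hj => ?_, ?_⟩
    · rw [← testBit_eq_testBit_iff]
      apply habove
      have : Fin.rev (Fin.rev ⟨k, hkn⟩) < Fin.rev j := Fin.rev_lt_rev.mpr hj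
      rw [Fin.rev_rev] at this
      exact this
    · rw [Fin.rev_rev]
      show (a : ℕ) / 2 ^ k % 2 < (b : ℕ) / 2 ^ k % 2
      rw [(testBit_eq_false_iff _ _).mp hbits.1, (testBit_eq_true_iff _ _).mp hbits.2]
      exact Nat.zero_lt_one
  · rintro ⟨i, hpre, hlt⟩
    have ha2 := Nat.mod_two_eq_zero_or_one ((a : ℕ) / 2 ^ ((Fin.rev i : Fin n) : ℕ))
    have hb2 := Nat.mod_two_eq_zero_or_one ((b : ℕ) / 2 ^ ((Fin.rev i : Fin n) : ℕ))
    have h0 : (a : ℕ) / 2 ^ ((Fin.rev i : Fin n) : ℕ) % 2 = 0 := by omega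
    have h1 : (b : ℕ) / 2 ^ ((Fin.rev i : Fin n) : ℕ) % 2 = 1 := by omega
    refine Fin.lt_def.mpr (Nat.lt_of_testBit ((Fin.rev i : Fin n) : ℕ)
      ((testBit_eq_false_iff _ _).mpr h0) ((testBit_eq_true_iff _ _).mpr h1) fun j hj => ?_)
    by_cases hjn : j < n
    · -- `j = rev i'` with `i' < i`
      have hi' : Fin.rev ⟨j, hjn⟩ < i := by
        rw [← Fin.rev_lt_rev, Fin.rev_rev]
        exact hj
      have := hpre _ hi'
      rw [Fin.rev_rev] at this
      exact (testBit_eq_testBit_iff _ _ _).mpr this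
    · push Not at hjn
      have h2 : 2 ^ n ≤ 2 ^ j := Nat.pow_le_pow_right (by norm_num) hjn
      rw [Nat.testBit_lt_two_pow (a.isLt.trans_le h2), Nat.testBit_lt_two_pow (b.isLt.trans_le h2)]

/-! ### The explicit orders `monomialCompatibleOrder σ` are monomial compatible, and conversely -/

/-- Coordinates of t21's explicit order: the monomial numbered `j` has exponent `bit_k(j)` at the
variable `σ k`. [cite: ForbesShpilkaVolk2018, §7.1] -/
theorem monomialCompatibleOrder_apply_perm (σ : Equiv.Perm (Fin n)) (j : Fin (2 ^ n)) (k : Fin n) :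
    ((monomialCompatibleOrder σ j : multilinearMonomials n) : Fin n →₀ ℕ) (σ k) =
      (j : ℕ) / 2 ^ (k : ℕ) % 2 := by
  rw [← finFunctionFinEquiv_symm_val]
  simp [monomialCompatibleOrder, multilinearEquivBits, Equiv.arrowCongr_apply]

/-- **Every explicit order is monomial compatible**, with priority permutation `k ↦ σ (rev k)`
(most significant bit first). [cite: ForbesShpilkaVolk2018, §7.1] -/
theorem isMonomialCompatible_monomialCompatibleOrder (σ : Equiv.Perm (Fin n)) :
    IsMonomialCompatible (monomialCompatibleOrder σ) := by
  refine ⟨Fin.revPerm.trans σ, fun a b => ?_⟩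
  have hfun : ∀ c : Fin (2 ^ n), (fun i : Fin n =>
      ((monomialCompatibleOrder σ c : multilinearMonomials n) : Fin n →₀ ℕ)
        ((Fin.revPerm.trans σ) i)) =
      fun i : Fin n => (c : ℕ) / 2 ^ ((Fin.rev i : Fin n) : ℕ) % 2 := by
    intro c
    funext i
    rw [Equiv.trans_apply, Fin.revPerm_apply, monomialCompatibleOrder_apply_perm]
  rw [hfun a, hfun b]
  exact lt_iff_toLex_bits_lt a b

/-- A multilinear exponent vector is determined by its values along a permutation. [folklore] -/
private theorem key_injective (τ : Equiv.Perm (Fin n)) :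
    Function.Injective fun m : multilinearMonomials n =>
      toLex fun i : Fin n => ((m : multilinearMonomials n) : Fin n →₀ ℕ) (τ i) := by
  intro m m' h
  apply Subtype.ext
  ext k
  have := congrFun (toLex.injective h) (τ.symm k)
  simpa using this

/-- **The two renderings match**: an ordering of the `2ⁿ` multilinear monomials is monomial
compatible (t18's `IsMonomialCompatible`) iff it is one of t21's explicit orders
`monomialCompatibleOrder σ` — two strictly monotone bijections from `Fin (2ⁿ)` onto the same
linearly ordered set coincide. [cite: ForbesShpilkaVolk2018, §7.1] -/
theorem isMonomialCompatible_iff (π : Fin (2 ^ n) ≃ multilinearMonomials n) :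
    IsMonomialCompatible π ↔ ∃ σ : Equiv.Perm (Fin n), π = monomialCompatibleOrder σ := by
  constructor
  · rintro ⟨τ, hτ⟩
    -- the explicit order with the same priority permutation
    set σ : Equiv.Perm (Fin n) := Fin.revPerm.trans τ with hσ
    refine ⟨σ, ?_⟩
    -- the explicit order is compatible with the SAME priority permutation `τ`
    have hμ : ∀ a b : Fin (2 ^ n), a < b ↔
        toLex (fun i : Fin n => ((monomialCompatibleOrder σ a : multilinearMonomials n) :
          Fin n →₀ ℕ) (τ i)) <
        toLex (fun i : Fin n => ((monomialCompatibleOrder σ b : multilinearMonomials n) :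
          Fin n →₀ ℕ) (τ i)) := by
      intro a b
      have hfun : ∀ c : Fin (2 ^ n), (fun i : Fin n =>
          ((monomialCompatibleOrder σ c : multilinearMonomials n) : Fin n →₀ ℕ) (τ i)) =
          fun i : Fin n => (c : ℕ) / 2 ^ ((Fin.rev i : Fin n) : ℕ) % 2 := by
        intro c
        funext i
        have : τ i = σ (Fin.rev i) := by
          rw [hσ, Equiv.trans_apply, Fin.revPerm_apply, Fin.rev_rev]
        rw [this, monomialCompatibleOrder_apply_perm]
      rw [hfun a, hfun b]
      exact lt_iff_toLex_bits_lt a b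
    -- both `key ∘ π` and `key ∘ μ` are strictly monotone with the same range
    let key : multilinearMonomials n → Lex (Fin n → ℕ) := fun m =>
      toLex fun i : Fin n => ((m : multilinearMonomials n) : Fin n →₀ ℕ) (τ i)
    have hf : StrictMono (key ∘ π) := fun a b hab => (hτ a b).mp hab
    have hg : StrictMono (key ∘ (monomialCompatibleOrder σ)) := fun a b hab => (hμ a b).mp hab
    have hrange : Set.range (key ∘ π) = Set.range (key ∘ (monomialCompatibleOrder σ)) := by
      rw [Set.range_comp, Set.range_comp, π.range_eq_univ, (monomialCompatibleOrder σ).range_eq_univ]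
    have heq := (hf.range_inj hg).mp hrange
    exact Equiv.ext fun a => key_injective τ (congrFun heq a)
  · rintro ⟨σ, rfl⟩
    exact isMonomialCompatible_monomialCompatibleOrder σ

/-! ### Thm. 10 from Lemma 55 -/

/-- A renaming of a multilinear polynomial along a permutation is multilinear. [folklore] -/
private theorem multilinear_rename {F : Type*} [CommSemiring F] (σ : Equiv.Perm (Fin n))
    {f : MvPolynomial (Fin n) F} (hf : ∀ m ∈ f.support, m ∈ multilinearMonomials n) :
    ∀ m ∈ (rename σ f).support, m ∈ multilinearMonomials n := by
  classical
  intro m hm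
  rw [support_rename_of_injective σ.injective, Finset.mem_image] at hm
  obtain ⟨m₀, hm₀, rfl⟩ := hm
  intro i
  rw [show i = σ (σ.symm i) by simp, Finsupp.mapDomain_apply σ.injective]
  exact hf m₀ hm₀ _

end FSV2018Thm10Bridge

open FSV2018Thm10Bridge

/-- **FSV Thm. 10 (ToC Thm. 1.11) from the named fact Lemma 55** (`FSV2018_thm10` in the corrected
form with `0 < n`, p421345). If the Forbes–Shpilka generator hits roABPs in the binary order over
every field (`ForbesShpilkaVolk2018_lemma55`), then over every infinite field, for every
monomial-compatible ordering `π` of the `N = 2ⁿ` coordinates (`n ≥ 1`), the multilinear polynomials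
computed by width-`w²` roABPs (in some order of `x_1, …, x_n`) form a succinct hitting set for the
width-`w`, individual-degree-`d` roABPs reading the coordinates in the order `π`. Proof: `π` is one
of the explicit orders (`isMonomialCompatible_iff`), and Cor. 60's argument applies with the explicit
multilinear witness `P^{FS}(x_σ, α)`; `w = 0` is vacuous (`IsROABP` carries `0 < w`).
[cite: ForbesShpilkaVolk2018, Thm. 10 and Cor. 60] -/
theorem FSV2018_thm10_of_lemma55
    (h55 : ∀ (F : Type) [Field F], ForbesShpilkaVolk2018_lemma55 F) : FSV2018_thm10 := by
  intro F _ _ n w d π hn hπ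
  obtain ⟨σ, rfl⟩ := (isMonomialCompatible_iff π).mp hπ
  rintro D ⟨-, hD⟩ hD0
  -- width `0` is excluded by `IsROABP` itself
  obtain ⟨hw, -⟩ := id hD
  -- admissible parameters (t21's `exists_fsParams`)
  obtain ⟨ω, β, hβ, hω, hord⟩ := exists_fsParams (F := F) ((2 ^ n * d * w ^ 2) ^ 2) w
  -- Cor. 60's argument, with the explicit multilinear witness
  set ψ := (permMonomials σ).symm with hψ
  have hD' : IsROABP F w d (binaryOrder n) (MvPolynomial.rename ψ D) := by
    have h := hD.rename ψ
    rwa [monomialCompatibleOrder_eq_trans, Equiv.trans_assoc, Equiv.self_trans_symm,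
      Equiv.trans_refl] at h
  have hD0' : MvPolynomial.rename ψ D ≠ 0 := fun h =>
    hD0 (rename_injective _ ψ.injective (by rw [h, map_zero]))
  obtain ⟨α, hα⟩ := (h55 F n w d ω β hβ hω hord).exists_eval_genOutput_ne_zero hD' hD0'
  refine ⟨MvPolynomial.rename σ (fsPoly n w d ω β α), ⟨?_, σ, 1, ?_⟩, ?_⟩
  · refine multilinear_rename σ fun m hm => ?_
    by_contra hmm
    exact (mem_support_iff.mp hm) (by rw [coeff_fsPoly, dif_neg hmm])
  · have h := (isROABP_fsPoly (n := n) hw hn d ω β α).rename σ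
    rwa [Equiv.refl_trans] at h
  · rw [← coeffVector_fsPoly, eval_rename] at hα
    have hv : coeffVector (multilinearMonomials n) (MvPolynomial.rename σ (fsPoly n w d ω β α)) =
        coeffVector (multilinearMonomials n) (fsPoly n w d ω β α) ∘ ψ := by
      funext m
      simp only [Function.comp_apply, coeffVector_apply]
      have hm : (m : Fin n →₀ ℕ) =
          Finsupp.mapDomain σ ((ψ m : multilinearMonomials n) : Fin n →₀ ℕ) := by
        rw [← Finsupp.equivMapDomain_eq_mapDomain]
        ext i
        simp [hψ, permMonomials, Finsupp.equivMapDomain_apply]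
      rw [hm, coeff_rename_mapDomain _ σ.injective]
    rw [hv]
    exact hα

end Literature.Computability.AlgebraicComplexity

end
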